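/-
Route lead rlead-rh-ScrewPolyaSigns g2, 2026-08-30.  LADDER-RH bookkeeping (route ScrewPolyaSigns, D-0179
split-or-blocker check, gen 2): the LEVEL LADDER of the residual — the one NON-degenerate variant of the
sign-change coordinates (sign changes of `Ψ − c` instead of `Ψ`) is, for every real level `c`, AT LEAST as
strong as RH (kernel), so it does not shrink the blocker either.  Nothing in this file bears on the truth of RH.
-/
import Summits.RiemannHypothesis.RiemannHypothesis.Theorems.ScrewPolyaSignsResidualIff
import HarnessLib

/-!
# Route `ScrewPolyaSigns`: the level ladder `LSS(c)` (sign changes of `Ψ − c`) — every rung implies RH (kernel)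

Gen-0 of this lead certified `RH ↔ ScrewSignSparse` [24182] (`ScrewPolyaSignsResidualIff`): the residual is
RH in costume because the sign-change coordinates DEGENERATE under RH (`Ψ ≥ 0`, no alternating pair,
`D = B = 0`).  The census of record (BLOCKER-24182.md §6) left ONE loophole open: "a NON-degenerate observable
of `Ψ`".  Inside the Pólya-signs mechanism the only such observable is the sign pattern of `Ψ − c` for a LEVEL
`c ≠ 0`: under RH `Ψ(t) = ∑_γ (1 − cos γt)/γ²` is almost periodic with mean `M = ∑_γ γ⁻² ≈ 0.046` and
`inf_{t ≥ 1} Ψ = 0`, so for `0 < c < sup Ψ` the function `Ψ − c` DOES change sign under RH (infinitely often;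
at `c = M` with upper density `≥ γ₁/π ≈ 4.499` by Pólya–Landau–Grosswald itself, the pole of `R` at `s = 0`
being removed by the centring).  This file proves that the level version still IMPLIES RH for EVERY real `c`:

* `LSS(c)` (inlined predicate): the strictly sign-alternating chains of `Ψ − c` in `[0,T]` have length `≤ D·T + B`
  for some `D` with `πD < 10⁵` (`c = 0` is literally `ScrewSignSparse`, `levelSignSparse_zero_iff`);
* `levelAssembly c : PolyaLandauR → LSS(c) → RH` — the bridge `AssemblyR` [24465] re-run with
  `g = Ψ∘log − c`, whose Mellin transform is `R(s) − c/s` (`R(s) = s⁻² ξ′/ξ(1/2+s)`); the extra pole at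
  `s = 0` never enters: the Pólya box sits around the abscissa `θ₀ = Θ − 1/2 > 0` with margin `η ≤ θ₀/2`,
  and the continuation half-plane is shrunk to `{θ₀/2 < re}` before the order comparison at a zero;
* `riemannHypothesis_of_levelSignSparse c : LSS(c) → RH` (with the tree theorem
  `polyaLandauR_proof` [24464]; computational lane inherited from the `10⁵` strip certificate);
* `riemannHypothesis_iff_levelSignSparse_of_nonpos : c ≤ 0 → (RH ↔ LSS(c))` — for `c ≤ 0` the
  rung degenerates exactly like `c = 0` (`Ψ − c ≥ 0` under RH).

VERDICT carried by these theorems (BLOCKER-24182 addendum g2, candidate (f)): for `c ≤ 0` the rung is RH in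
costume; for `c > 0` it is `RH ∧ U_c` with `U_c` = «under RH the `c`-crossings of the almost periodic `Ψ` have
upper density `< 10⁵/π`», an OPEN level-crossing bound — so the rung is STRONGER than RH, never weaker.  No rung
of the level ladder is a piece strictly weaker than the summit; the blocker [24182] stands.  0 summit credit.
RH is not proved.
-/

-- D-0017: `Summit.RiemannHypothesis.RiemannHypothesis.…` duplicates the namespace BY DESIGN (single-problem summit).
set_option linter.dupNamespace false

noncomputable section

open Complex Filter Topology Set MeasureTheory
open scoped Real
open Literature.NumberTheory.LFunctions

namespace Summit.RiemannHypothesis.RiemannHypothesis.Theorems.ScrewPolyaSignsLevelLadder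

open Summit.RiemannHypothesis.RiemannHypothesis.Theses.ScrewPolyaSigns

/-! ### The rung predicate `LSS(c)` (inlined — D-0027 §2.1: no unregistered `Prop` definitions under `Summits/`)

`LSS(c)` := `∃ D B : ℝ, π·D < 10⁵ ∧ ∀ T ≥ 0, ∀ n, ∀ t : Fin (n+1) → ℝ` strictly increasing in `[0,T]` with
`(Ψ(tᵢ) − c)·(Ψ(tᵢ₊₁) − c) < 0` for all `i`, `n ≤ D·T + B` — literally `ScrewSignSparse` [24182] with `Ψ` replaced
by `Ψ − c`; it is spelled out in each statement below. -/

/-- Rung `0` is the route's residual `ScrewSignSparse` [24182]. -/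
theorem levelSignSparse_zero_iff :
    (∃ D B : ℝ, Real.pi * D < 100000 ∧ ∀ T : ℝ, 0 ≤ T → ∀ (n : ℕ) (t : Fin (n + 1) → ℝ), StrictMono t →
      (∀ i, t i ∈ Set.Icc 0 T) →
      (∀ i : Fin n, (zetaScrew (t i.castSucc) - 0) * (zetaScrew (t i.succ) - 0) < 0) → (n : ℝ) ≤ D * T + B) ↔
      ScrewSignSparse := by
  simp only [ScrewSignSparse, sub_zero]

/-- For `c ≤ 0` the rung degenerates under RH exactly like the residual: `Ψ − c ≥ 0`, no alternating
pair, `D = B = 0`. -/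
theorem levelSignSparse_of_riemannHypothesis_of_nonpos {c : ℝ} (hc : c ≤ 0)
    (hRH : Summit.RiemannHypothesis) :
    (∃ D B : ℝ, Real.pi * D < 100000 ∧ ∀ T : ℝ, 0 ≤ T → ∀ (n : ℕ) (t : Fin (n + 1) → ℝ), StrictMono t →
      (∀ i, t i ∈ Set.Icc 0 T) →
      (∀ i : Fin n, (zetaScrew (t i.castSucc) - c) * (zetaScrew (t i.succ) - c) < 0) → (n : ℝ) ≤ D * T + B) := by
  refine ⟨0, 0, by norm_num, ?_⟩
  intro T _ n t _ _ halt
  cases n with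
  | zero => simp
  | succ k =>
    have hR := Summit.RiemannHypothesis_iff.1 hRH
    have ha := ZetaScrewThm17.zetaScrew_nonneg_of_RH hR (t (⟨0, by omega⟩ : Fin (k + 1)).castSucc)
    have hb := ZetaScrewThm17.zetaScrew_nonneg_of_RH hR (t (⟨0, by omega⟩ : Fin (k + 1)).succ)
    exact absurd (halt ⟨0, by omega⟩) (not_lt.2 (mul_nonneg (by linarith) (by linarith)))

/-- The Mellin transform of `x ↦ Ψ(log x) − c` on `re s > 1` is `R(s) − c/s`. -/
theorem mellinIoi_level_eq (c : ℝ) {s : ℂ} (hs : (1 : ℝ) < s.re) :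
    Landau.mellinIoi (fun x : ℝ ↦ zetaScrew (Real.log x) - c) s =
      1 / s ^ 2 * logDeriv riemannXi (1 / 2 + s) - (c : ℂ) / s := by
  have hs1 : (-(s + 1)).re < -1 := by simp; linarith
  have hmeas : Measurable (fun x : ℝ ↦ zetaScrew (Real.log x)) :=
    continuous_zetaScrew.measurable.comp Real.measurable_log
  have hI1 : IntegrableOn (fun x : ℝ ↦ (zetaScrew (Real.log x) : ℂ) * (x : ℂ) ^ (-(s + 1))) (Ioi 1) := by
    have h := Landau.integrable_mellinIntegrand (g := fun x : ℝ ↦ zetaScrew (Real.log x)) hmeas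
      (σ₁ := 1) (ZetaScrewLandau.integrableOn_zetaScrew_log_rpow (by norm_num)) 0 (s := s) hs
    refine (h.congr ?_)
    refine Eventually.of_forall fun x ↦ ?_
    simp [Landau.mellinIntegrand]
  have hI2 : IntegrableOn (fun x : ℝ ↦ (c : ℂ) * (x : ℂ) ^ (-(s + 1))) (Ioi 1) :=
    (integrableOn_Ioi_cpow_of_lt hs1 zero_lt_one).const_mul _
  have hs0 : s ≠ 0 := fun h ↦ by rw [h, zero_re] at hs; linarith
  have hint2 : ∫ x in Ioi (1 : ℝ), (x : ℂ) ^ (-(s + 1)) = 1 / s := by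
    rw [integral_Ioi_cpow_of_lt hs1 zero_lt_one, Complex.ofReal_one, Complex.one_cpow]
    have : (-(s + 1) + 1 : ℂ) = -s := by ring
    rw [this, neg_div_neg_eq]
  calc Landau.mellinIoi (fun x : ℝ ↦ zetaScrew (Real.log x) - c) s
      = ∫ x in Ioi (1 : ℝ), ((zetaScrew (Real.log x) : ℂ) * (x : ℂ) ^ (-(s + 1))
          - (c : ℂ) * (x : ℂ) ^ (-(s + 1))) := by
        unfold Landau.mellinIoi
        refine setIntegral_congr_fun measurableSet_Ioi fun x _ ↦ ?_
        push_cast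
        ring
    _ = (∫ x in Ioi (1 : ℝ), (zetaScrew (Real.log x) : ℂ) * (x : ℂ) ^ (-(s + 1)))
          - ∫ x in Ioi (1 : ℝ), (c : ℂ) * (x : ℂ) ^ (-(s + 1)) := integral_sub hI1 hI2
    _ = 1 / s ^ 2 * logDeriv riemannXi (1 / 2 + s) - (c : ℂ) / s := by
        rw [integral_const_mul, hint2, ← ZetaScrewLandau.mellinIoi_eq_of_re_gt (by linarith)]
        simp only [Landau.mellinIoi]
        ring

/-- **The level bridge: `PolyaLandauR → LSS(c) → RH` for every real level `c`.**
(`AssemblyR` [24465] verbatim with `g = Ψ∘log − c` and `Φ = R − c/s`; the pole at `0` is kept outside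
the Pólya box by `η ≤ θ₀/2` and outside the continuation half-plane by shrinking `ε` to `≤ θ₀/2`.) -/
theorem levelAssembly (c : ℝ) (hPLR : PolyaLandauR)
    (hLSS : ∃ D B : ℝ, Real.pi * D < 100000 ∧ ∀ T : ℝ, 0 ≤ T → ∀ (n : ℕ) (t : Fin (n + 1) → ℝ), StrictMono t →
      (∀ i, t i ∈ Set.Icc 0 T) →
      (∀ i : Fin n, (zetaScrew (t i.castSucc) - c) * (zetaScrew (t i.succ) - c) < 0) → (n : ℝ) ≤ D * T + B) :
    Summit.RiemannHypothesis := by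
  refine (Summit.RiemannHypothesis_iff).2 (quasiRiemannHypothesis_one_half_iff_holds.1 ?_)
  by_contra hQ
  -- the real parts of the zeros in the right half of the strip
  set S : Set ℝ := {σ | ∃ s : ℂ, riemannZeta s = 0 ∧ 1 / 2 < s.re ∧ s.re < 1 ∧ s.re = σ} with hS_def
  have hSne : S.Nonempty := by
    by_contra hne
    refine hQ fun s hs h1 h2 ↦ hne ⟨s.re, s, hs, h1, h2, rfl⟩
  have hSbdd : BddAbove S := ⟨1, fun σ ⟨s, _, _, h2, hσ⟩ ↦ hσ ▸ h2.le⟩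
  set Θ : ℝ := sSup S with hΘ_def
  have hΘgt : 1 / 2 < Θ := by
    obtain ⟨σ, hσ⟩ := hSne
    have hσ' : σ ∈ S := hσ
    obtain ⟨s, _, h1, _, hs⟩ := hσ'
    exact lt_of_lt_of_le (hs ▸ h1) (le_csSup hSbdd hσ)
  have hΘle : Θ ≤ 1 := csSup_le hSne fun σ ⟨s, _, _, h2, hσ⟩ ↦ hσ ▸ h2.le
  -- no zero of `ξ(1/2 + ·)` to the right of `θ₀ = Θ - 1/2`
  have hfree : ∀ s : ℂ, Θ - 1 / 2 < s.re → riemannXi (1 / 2 + s) ≠ 0 := by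
    intro s hs hξ
    obtain ⟨hζ, h0, h1, -⟩ := riemannXi_zero_prop hξ
    have hre : (1 / 2 + s : ℂ).re = 1 / 2 + s.re := by simp
    by_cases hhalf : 1 / 2 < (1 / 2 + s : ℂ).re
    · have hmem : (1 / 2 + s : ℂ).re ∈ S := ⟨1 / 2 + s, hζ, hhalf, h1, rfl⟩
      have := le_csSup hSbdd hmem
      rw [hre] at this
      linarith
    · rw [hre] at hhalf
      linarith
  set θ₀ : ℝ := Θ - 1 / 2 with hθ₀_def
  have hθ₀ : 0 < θ₀ := by rw [hθ₀_def]; linarith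
  have hθ₀' : θ₀ ≤ 1 / 2 := by rw [hθ₀_def]; linarith
  obtain ⟨D, B, hπD, hchain⟩ := hLSS
  set η : ℝ := min (θ₀ / 2) ((100000 - Real.pi * D) / 2) with hη_def
  have hη : 0 < η := lt_min (by positivity) (by linarith)
  have hη1 : η ≤ θ₀ / 2 := min_le_left _ _
  have hη2 : η ≤ (100000 - Real.pi * D) / 2 := min_le_right _ _
  set g : ℝ → ℝ := fun x ↦ zetaScrew (Real.log x) - c with hg_def
  -- (H1) continuity on (1, ∞)
  have hg_cont : ContinuousOn g (Ioi 1) :=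
    (continuous_zetaScrew.comp_continuousOn
      (Real.continuousOn_log.mono fun x hx ↦ (zero_lt_one.trans (by exact hx)).ne')).sub
      continuousOn_const
  -- (H2) integrability at σ₁ = 1
  have hg_int : IntegrableOn (fun x : ℝ ↦ g x * x ^ (-((1 : ℝ) + 1))) (Ioi 1) := by
    have h1 : IntegrableOn (fun x : ℝ ↦ zetaScrew (Real.log x) * x ^ (-((1 : ℝ) + 1))) (Ioi 1) :=
      ZetaScrewLandau.integrableOn_zetaScrew_log_rpow (by norm_num)
    have h2 : IntegrableOn (fun x : ℝ ↦ c * x ^ (-((1 : ℝ) + 1))) (Ioi 1) :=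
      (integrableOn_Ioi_rpow_of_lt (by norm_num) zero_lt_one).const_mul c
    refine (h1.sub h2).congr_fun (fun x _ ↦ ?_) measurableSet_Ioi
    simp only [hg_def, Pi.sub_apply]
    ring
  -- (H3) chain bound transported by t = log x
  have hg_chain : ∀ X : ℝ, 1 ≤ X → ∀ (n : ℕ) (x : Fin (n + 1) → ℝ), StrictMono x →
      (∀ i, x i ∈ Set.Ioc 1 X) → (∀ i : Fin n, g (x i.castSucc) * g (x i.succ) < 0) →
      (n : ℝ) ≤ D * Real.log X + B := by
    intro X hX n x hmono hmem halt
    refine hchain (Real.log X) (Real.log_nonneg hX) n (fun i ↦ Real.log (x i)) ?_ ?_ ?_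
    · exact fun i j hij ↦ Real.log_lt_log (zero_lt_one.trans (hmem i).1) (hmono hij)
    · intro i
      exact ⟨(Real.log_pos (hmem i).1).le,
        Real.log_le_log (zero_lt_one.trans (hmem i).1) (hmem i).2⟩
    · intro i
      exact halt i
  -- the continuation `Φ = R − c/s`
  set Φ : ℂ → ℂ := fun s : ℂ ↦ 1 / s ^ 2 * logDeriv riemannXi (1 / 2 + s) - (c : ℂ) / s with hΦ_def
  have hΦmero : MeromorphicOn Φ {s : ℂ | θ₀ - 1 < s.re} := fun s hs ↦
    (ScrewPolyaSignsAssemblyR.meromorphicOn_R _ s hs).sub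
      (analyticAt_const.meromorphicAt.div analyticAt_id.meromorphicAt)
  -- (H7) holomorphy of Φ on {θ₀ < re} ∪ the pole-free box (verified height 10⁵); `s = 0` is outside both
  have hdiff : DifferentiableOn ℂ Φ
      ({s : ℂ | θ₀ < s.re} ∪ {s : ℂ | θ₀ - η < s.re ∧ |s.im| < Real.pi * D + η}) := by
    intro s hs
    have hs0 : s ≠ 0 := by
      intro h0
      rcases hs with hs | hs
      · simp only [Set.mem_setOf_eq, h0, zero_re] at hs; linarith
      · have := hs.1; rw [h0, zero_re] at this; linarith
    have hξ : riemannXi (1 / 2 + s) ≠ 0 := by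
      rcases hs with hs | hs
      · exact hfree s hs
      · intro hξ
        obtain ⟨hζ, h0, h1, -⟩ := riemannXi_zero_prop hξ
        have hre : (1 / 2 + s : ℂ).re = 1 / 2 + s.re := by simp
        have him : (1 / 2 + s : ℂ).im = s.im := by simp
        have habs : |(1 / 2 + s : ℂ).im| ≤ 100000 := by
          rw [him]; linarith [hs.2]
        have := riemannHypothesisInStripUpTo_100000 (1 / 2 + s) hζ h0 h1 habs
        rw [hre] at this
        linarith [hs.1]
    exact ((ZetaScrewLandau.differentiableAt_R hs0 hξ).sub
      ((differentiableAt_const (c : ℂ)).div differentiableAt_id hs0)).differentiableWithinAt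
  -- (H8) Φ = mellinIoi g on re s > 1
  have heq : EqOn Φ (Landau.mellinIoi g) {s : ℂ | (1 : ℝ) < s.re} := fun s hs ↦
    (mellinIoi_level_eq c (by simpa only [Set.mem_setOf_eq] using hs)).symm
  -- apply Pólya–Landau–Grosswald
  obtain ⟨ε, hε, Φ', hΦ'diff, hΦ'eq⟩ := hPLR g 1 θ₀ 1 η D B hg_cont hg_int hg_chain (by linarith)
    one_pos hη Φ hΦmero hdiff heq
  -- shrink the continuation half-plane so that it misses the pole `s = 0` of `c/s`
  set ε' : ℝ := min ε (θ₀ / 2) with hε'_def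
  have hε' : 0 < ε' := lt_min hε (by positivity)
  have hε'1 : ε' ≤ ε := min_le_left _ _
  have hε'2 : ε' ≤ θ₀ / 2 := min_le_right _ _
  -- a zero `1/2 + w₀` with `θ₀ - ε' < re w₀`
  obtain ⟨σ, hσS, hσgt⟩ := exists_lt_of_lt_csSup hSne (show Θ - ε' < Θ by linarith)
  obtain ⟨s₁, hζ₁, h1₁, h2₁, hs₁σ⟩ := hσS
  set w₀ : ℂ := s₁ - 1 / 2 with hw₀_def
  have hzero : riemannXi (1 / 2 + w₀) = 0 := by
    rw [hw₀_def, show (1 / 2 : ℂ) + (s₁ - 1 / 2) = s₁ by ring]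
    exact (riemannXi_eq_zero_iff_holds s₁).2 ⟨hζ₁, by linarith, h2₁⟩
  -- ENDGAME (as in `assemblyR`, with `Φ'' = Φ' + c/s` on `H = {θ₀ − ε' < re}`, `0 ∉ H`)
  set H : Set ℂ := {s : ℂ | θ₀ - ε' < s.re} with hH_def
  have hHo : IsOpen H := isOpen_lt continuous_const Complex.continuous_re
  have hHpre : IsPreconnected H := (convex_halfSpace_re_gt (θ₀ - ε')).isPreconnected
  have hH0 : ∀ s ∈ H, s ≠ 0 := by
    intro s hs h0
    simp only [hH_def, Set.mem_setOf_eq, h0, zero_re] at hs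
    linarith
  have hHsub : H ⊆ {s : ℂ | θ₀ - ε < s.re} := fun s hs ↦ by
    simp only [hH_def, Set.mem_setOf_eq] at hs ⊢
    linarith
  set Φ'' : ℂ → ℂ := fun s ↦ Φ' s + (c : ℂ) / s with hΦ''_def
  have hΦ''diff : DifferentiableOn ℂ Φ'' H := fun s hs ↦
    ((hΦ'diff s (hHsub hs)).mono hHsub).add
      (((differentiableAt_const (c : ℂ)).div differentiableAt_id (hH0 s hs)).differentiableWithinAt)
  set Z : ℂ → ℂ := fun s ↦ riemannXi (1 / 2 + s) with hZ_def
  have hZd : Differentiable ℂ Z := differentiable_riemannXi.comp (by fun_prop)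
  have hZa : ∀ s, AnalyticAt ℂ Z s := fun s ↦ hZd.analyticAt s
  have hderivZ : ∀ s, deriv Z s = deriv riemannXi (1 / 2 + s) := fun s ↦ by
    simp only [hZ_def]
    exact deriv_comp_const_add riemannXi (1 / 2) s
  set G : ℂ → ℂ := fun s ↦ Φ'' s * s ^ 2 with hG_def
  have hGa : ∀ s ∈ H, AnalyticAt ℂ G s := fun s hs ↦
    ((hΦ''diff.analyticOnNhd hHo) s hs).mul ((analyticAt_id.pow 2))
  have hf₁ : AnalyticOnNhd ℂ (G * Z) H := fun s hs ↦ (hGa s hs).mul (hZa s)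
  have hf₂ : AnalyticOnNhd ℂ (deriv Z) H := fun s _ ↦ (hZa s).deriv
  have h2H : (2 : ℂ) ∈ H := by
    simp only [hH_def, Set.mem_setOf_eq]
    norm_num
    linarith
  have hev2 : (G * Z) =ᶠ[𝓝 (2 : ℂ)] deriv Z := by
    have hopen : IsOpen {s : ℂ | (1 : ℝ) < s.re} := isOpen_lt continuous_const Complex.continuous_re
    filter_upwards [hopen.mem_nhds (show (2 : ℂ) ∈ {s : ℂ | (1 : ℝ) < s.re} by simp)] with s hs
    have hs' : (1 : ℝ) < s.re := hs
    have hξ : riemannXi (1 / 2 + s) ≠ 0 := riemannXi_ne_zero_of_one_le_re (by simp; linarith)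
    have hs0 : s ≠ 0 := fun h ↦ by rw [h, zero_re] at hs'; linarith
    rw [Pi.mul_apply, hderivZ s]
    simp only [hG_def, hΦ''_def, hZ_def]
    rw [hΦ'eq hs, ← heq hs]
    simp only [hΦ_def, logDeriv_apply, sub_add_cancel]
    set A : ℂ := deriv riemannXi (1 / 2 + s)
    set B' : ℂ := riemannXi (1 / 2 + s)
    field_simp
  have hEqOn : EqOn (G * Z) (deriv Z) H := hf₁.eqOn_of_preconnected_of_eventuallyEq hf₂ hHpre h2H hev2
  have hw₀H : w₀ ∈ H := by
    simp only [hH_def, hw₀_def, Set.mem_setOf_eq, sub_re]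
    norm_num
    rw [hθ₀_def]
    linarith
  have hev : deriv Z =ᶠ[𝓝 w₀] G * Z := by
    filter_upwards [hHo.mem_nhds hw₀H] with s hs
    exact (hEqOn hs).symm
  have hZ0 : Z w₀ = 0 := hzero
  have h1 : analyticOrderAt (deriv Z) w₀ + 1 = analyticOrderAt Z w₀ := by
    have := (hZa w₀).analyticOrderAt_deriv_add_one
    simpa [hZ0] using this
  have h2 : analyticOrderAt (deriv Z) w₀ = analyticOrderAt G w₀ + analyticOrderAt Z w₀ := by
    rw [analyticOrderAt_congr hev, analyticOrderAt_mul (hGa w₀ hw₀H) (hZa w₀)]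
  rw [h2] at h1
  generalize hoZ : analyticOrderAt Z w₀ = oZ at h1
  generalize hoG : analyticOrderAt G w₀ = oG at h1
  cases oZ with
  | top =>
    have hloc : ∀ᶠ s in 𝓝 w₀, Z s = 0 := analyticOrderAt_eq_top.1 hoZ
    have hall : EqOn Z 0 univ :=
      (hZd.differentiableOn.analyticOnNhd isOpen_univ).eqOn_zero_of_preconnected_of_eventuallyEq_zero
        isPreconnected_univ (Set.mem_univ w₀) hloc
    have h1' : Z 1 = 0 := hall (Set.mem_univ 1)
    simp only [hZ_def] at h1'
    exact riemannXi_ne_zero_of_one_le_re (s := 1 / 2 + 1) (by norm_num) h1'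
  | coe n =>
    cases oG with
    | top => simp at h1
    | coe m =>
      have h' : (m + n + 1 : ℕ) = n := by exact_mod_cast h1
      omega

/-- **Every rung of the level ladder implies RH** (with the tree theorem `polyaLandauR_proof` [24464]). -/
theorem riemannHypothesis_of_levelSignSparse (c : ℝ)
    (hLSS : ∃ D B : ℝ, Real.pi * D < 100000 ∧ ∀ T : ℝ, 0 ≤ T → ∀ (n : ℕ) (t : Fin (n + 1) → ℝ), StrictMono t →
      (∀ i, t i ∈ Set.Icc 0 T) →
      (∀ i : Fin n, (zetaScrew (t i.castSucc) - c) * (zetaScrew (t i.succ) - c) < 0) → (n : ℝ) ≤ D * T + B) :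
    Summit.RiemannHypothesis :=
  levelAssembly c polyaLandauR_proof hLSS

/-- For `c ≤ 0` the rung is RH in costume (kernel iff), exactly like the residual `c = 0`. -/
theorem riemannHypothesis_iff_levelSignSparse_of_nonpos {c : ℝ} (hc : c ≤ 0) :
    Summit.RiemannHypothesis ↔
      (∃ D B : ℝ, Real.pi * D < 100000 ∧ ∀ T : ℝ, 0 ≤ T → ∀ (n : ℕ) (t : Fin (n + 1) → ℝ), StrictMono t →
      (∀ i, t i ∈ Set.Icc 0 T) →
      (∀ i : Fin n, (zetaScrew (t i.castSucc) - c) * (zetaScrew (t i.succ) - c) < 0) → (n : ℝ) ≤ D * T + B) :=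
  ⟨levelSignSparse_of_riemannHypothesis_of_nonpos hc, riemannHypothesis_of_levelSignSparse c⟩

end Summit.RiemannHypothesis.RiemannHypothesis.Theorems.ScrewPolyaSignsLevelLadder

end
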